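import Literature.NumberTheory.Automorphic.BorelOfBaseMaximal
import Literature.NumberTheory.Automorphic.IsomorphismTheoremUniqueLieHolds
import HarnessLib

/-!
# Springer 8.2.4 (i), maximality, in every characteristic: the discharge `borelOfBase_maximal_holds`
(trunk T-AUTOMORPHIC, G25 AutomorphicL; proof file of the named fact `borelOfBase_maximal` of
`ReductiveDualChevalleyBasedProofs.lean` — Springer, *Linear Algebraic Groups*, 2nd ed.,
Prop. 8.2.4 (i), p. 139: for `G` connected reductive over an algebraically closed field, `T` a
maximal torus, `R⁺` a system of positive roots, the subgroup `B(b) = ⟨T, U_α : α ∈ R⁺⟩` *"must be a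
Borel group"*; the fact is its maximality clause among the Zariski-connected solvable subgroups of
`G`, and it quantifies over every characteristic)

Printed proof (p. 139): *"`dim B̃ = dim T + ½|R|` (8.2.2) … by 6.2.7 (iii) and 8.1.3 (ii) `B̃` must be
a Borel group."* The tree's route (`BorelOfBaseMaximal.lean`, section `RankOne`) replaces the
dimension count by a weight-by-weight comparison of Lie algebras which needs, of the structure
theory, only the first clause `P ⊆ R` of Springer 8.1.2 (*"the roots of `R` are the non-zero weights
of `T` in `𝔤`"*): `borelOfBase_maximal_of_lieWeights_eq_roots : lieWeights_eq_roots →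
borelOfBase_maximal`, in every characteristic. The named fact `lieWeights_eq_roots` (8.1.2) is now a
theorem of the tree in every characteristic (`lieWeights_eq_roots_holds`,
`IsomorphismTheoremUniqueLieHolds.lean`: root homomorphisms exist in semisimple rank one, 7.3.3 (i)),
whence the closed discharges below:

* **`borelOfBase_maximal_holds : borelOfBase_maximal`** — Springer 8.2.4 (i), maximality;
* **`isBorelIn_borelOfBase_holds : isBorelIn_borelOfBase`** — Springer 8.2.4 (i) as printed
  (`B(b)` is a Borel subgroup of `G`), through `isBorelIn_borelOfBase_of_maximal` (closedness
  2.2.7 (i) and solvability 8.2.3 being theorems of `ReductiveDualChevalleyBasedProofs.lean`);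
* `IsRootDatumOf.isBasedRootDatumOf_borelOfBase` — `(P, b)` is the based root datum of
  `(G, B(b), T)` for every base `b` (8.2.4 (i) with 8.1.3 (i));
* `IsBorelIn.eq_borelOfBase_of_torus_le_of_rootSubgroup_le` — a Borel subgroup containing `T` and
  the root subgroups of the `b`-positive roots **is** `B(b)` (8.2.4 (i): `R⁺(B(b)) = R⁺`).

No named fact is introduced and no statement of the tree is changed.

## References

* [SpringerLAG1998] T. A. Springer, *Linear Algebraic Groups*, 2nd ed., Progress in Mathematics 9,
  Birkhäuser (1998): Prop. 8.2.4 (i) and its proof (p. 139), Cor. 8.1.2 (pp. 132–133),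
  Thm. 6.2.7 (iii), Cor. 8.1.3.
-/

noncomputable section

open scoped MatrixGroups IsMulCommutative

namespace Literature.NumberTheory.Automorphic

variable {k : Type*} [Field k] {n : Type*} [Fintype n] [DecidableEq n]
variable {ι X Y : Type*} [AddCommGroup X] [AddCommGroup Y]
variable {G T : Subgroup (GL n k)} [IsMulCommutative ↥T]
variable {P : RootPairing ι ℤ X Y} {eX : Additive ↥(characterLattice T) ≃+ X}
  {eY : Additive ↥(cocharacterLattice T) ≃+ Y}

/-- **Discharge of `borelOfBase_maximal` (Springer 8.2.4 (i), maximality clause), in every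
characteristic.** For `G ≤ GL n k` connected reductive over an algebraically closed field, `T` a
maximal torus, `P` the root datum of `(G, T)` and `b` a base: every Zariski-connected solvable
subgroup `B'` of `G` containing `B(b) = ⟨T, U_α : α ∈ R⁺(b)⟩` equals `B(b)`. Proof:
`borelOfBase_maximal_of_lieWeights_eq_roots` (the tree's Lie-algebra route, every characteristic)
applied to the theorem `lieWeights_eq_roots_holds` (Springer 8.1.2, `P = R`). In print: *"by 6.2.7
(iii) and 8.1.3 (ii) `B̃` must be a Borel group"*.
[cite: SpringerLAG1998, Prop. 8.2.4 (i) with Cor. 8.1.2, Thm. 6.2.7 (iii), Cor. 8.1.3 (ii)] -/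
theorem borelOfBase_maximal_holds :
    borelOfBase_maximal (G := G) (T := T) (ι := ι) (X := X) (Y := Y) :=
  borelOfBase_maximal_of_lieWeights_eq_roots lieWeights_eq_roots_holds

/-- **Discharge of `isBorelIn_borelOfBase` (Springer 8.2.4 (i) as printed), in every
characteristic**: for `G ≤ GL n k` connected reductive over an algebraically closed field, `T` a
maximal torus, `P` the root datum of `(G, T)` and `b` a base, `B(b) = ⟨T, U_α : α ∈ R⁺(b)⟩` is a
Borel subgroup of `G`. Closedness (2.2.7 (i)) and solvability (8.2.3) are the theorems
`isAlgebraicSubgroup_borelOfBase_holds`, `isSolvable_borelOfBase_holds`; maximality is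
`borelOfBase_maximal_holds` (`isBorelIn_borelOfBase_of_maximal`).
[cite: SpringerLAG1998, Prop. 8.2.4 (i)] -/
theorem isBorelIn_borelOfBase_holds :
    isBorelIn_borelOfBase (G := G) (T := T) (ι := ι) (X := X) (Y := Y) :=
  isBorelIn_borelOfBase_of_maximal borelOfBase_maximal_holds

/-- **`(P, b)` is the based root datum of `(G, B(b), T)`** (Springer 8.2.4 (i) with 8.1.3 (i)), in
every characteristic: if `P` is the root datum of `(G, T)`, `G` connected reductive with maximal
torus `T` over an algebraically closed field, then for every base `b` the triple `(G, B(b), T)`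
realizes `(P, b)` (`IsBasedRootDatumOf`), by `isBasedRootDatumOf_borelOfBase` and the discharge
`isBorelIn_borelOfBase_holds`. [cite: SpringerLAG1998, Prop. 8.2.4 (i)] -/
theorem IsRootDatumOf.isBasedRootDatumOf_borelOfBase [IsAlgClosed k]
    (hG : IsConnectedReductive G) (hT : IsMaximalTorusIn T G) (h : IsRootDatumOf G T P eX eY)
    (b : P.Base) :
    IsBasedRootDatumOf G T (borelOfBase G T P b eX) P b eX eY :=
  Literature.NumberTheory.Automorphic.isBasedRootDatumOf_borelOfBase
    isBorelIn_borelOfBase_holds hG hT h b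

/-- **The Borel subgroup of a positive system is unique** (Springer 8.2.4 (i):
`R⁺(B(b)) = R⁺(b)`), in every characteristic: for `G ≤ GL n k` connected reductive over an
algebraically closed field, `T` a maximal torus and `P` the root datum of `(G, T)` with base `b`, a
Borel subgroup `B` of `G` containing `T` and the root subgroups `U_α` of the `b`-positive roots is
`B(b)`; by `IsBorelIn.eq_borelOfBase_of_rootSubgroup_le` and `P ⊆ R` (`lieWeights_eq_roots_holds`).
[cite: SpringerLAG1998, Prop. 8.2.4 (i) with Cor. 8.1.2] -/
theorem IsBorelIn.eq_borelOfBase_of_torus_le_of_rootSubgroup_le [IsAlgClosed k]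
    (hG : IsConnectedReductive G) (hT : IsMaximalTorusIn T G) (h : IsRootDatumOf G T P eX eY)
    (b : P.Base) {B : Subgroup (GL n k)} (hB : IsBorelIn B G) (hTB : T ≤ B)
    (hUB : ∀ i, b.IsPos i → rootSubgroup G T (charOfWeight eX (P.root i)) ≤ B) :
    B = borelOfBase G T P b eX :=
  hB.eq_borelOfBase_of_rootSubgroup_le hG hT (lieWeights_eq_roots_holds hG hT).1.le h b hTB hUB

/-- **A Borel subgroup containing `B(b)` is `B(b)`** (Springer 8.2.4 (i)), in every
characteristic: the form of the maximality clause used by the route files, by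
`IsBorelIn.eq_borelOfBase_of_le` and `P ⊆ R` (`lieWeights_eq_roots_holds`).
[cite: SpringerLAG1998, Prop. 8.2.4 (i) with Cor. 8.1.2] -/
theorem IsBorelIn.eq_borelOfBase_of_borelOfBase_le [IsAlgClosed k]
    (hG : IsConnectedReductive G) (hT : IsMaximalTorusIn T G) (h : IsRootDatumOf G T P eX eY)
    (b : P.Base) {B : Subgroup (GL n k)} (hB : IsBorelIn B G)
    (hle : borelOfBase G T P b eX ≤ B) :
    B = borelOfBase G T P b eX :=
  hB.eq_borelOfBase_of_le hG hT (lieWeights_eq_roots_holds hG hT).1.le h b hle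

end Literature.NumberTheory.Automorphic
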